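import Summits.Ventures.PercRepro.ProfilePointedCircuitClassesTwelveQuadD

/-!
# PercRepro — THE TWELVE-POINT STATEMENT `InOutBottomTwelve` WHEN EVERY CO-RANK-2 QUADRUPLE CONTAINS A SERIES PAIR
WITH CO-INDEPENDENT COMPLEMENT, III: THE FOUR-NON-COLOOP DEMANDS, THE ASSEMBLY, THE TRANSFER
(p5, gen 43; `proofs/P5-GM1.md` §65(i))

A demand with FOUR non-coloops (`B = K ⊔ D`, `D` of rank `2` without coloops) sends `≥ 60` as soon as `D` contains
a parallel pair `{a, a'}` whose complement has rank `2` (`sixty_le_sum_pwt60b_of_card_eq_four`): its four disjoint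
units `B − a`, `B − a'`, `B − c`, `B − d` weigh `wt, wt, ≥ 12, ≥ 12` with `wt = 16` (a `(2,0)`-unit, one
substitution point) or `60 / (m + 1)`, `m := #(cw(W, a) ∖ S) ≤ 4`, and the clean units `K ∪ R + w`
(`w ∈ cw(W, a) ∖ S`, part II's `clean_pair_unit_facts`) add `4·m`: `32 + 24 + 4`, `120`, `60 + 24`, `40 + 24 + 8`,
`30 + 24 + 12`, `24 + 24 + 16`.  Assembly `60·#𝒟 ≤ Σ pwt60b ≤ 60·#𝒰` (`card_pdem_le_card_punit_of_quad2`) and the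
transfer: **`inCount_five_le_outCount_six_of_twelve_of_quad2`** — `in_5(e) ≤ out_6(e)` on every matroid with `12`
points and rank `7` in which every `4`-set `D` with `ρ(E ∖ D) = 5` contains a `3`-set `P` with `ρ(E ∖ P) = 5` or a
pair `{a, a'}` with `ρ(E ∖ {a, a'}) = 6` and `ρ(E ∖ (D ∖ {a, a'})) = 7` (every co-rank-2 quadruple contains a series
triple or a series pair with co-independent complement).  The hypothesis excludes exactly the four-point line and the
two parallel pairs of the dual; the quad regime of TwelveQuadB is the special case.
-/

open scoped Matroid

namespace PercRepro.Cogirth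

open Finset ThmH Skew Shadow Profile

variable {α : Type} [DecidableEq α] {M : Matroid α} [M.Finite]

section TwelveQuadE

/-- **THE DEMANDS WITH FOUR NON-COLOOPS**: when `nonco(W)` contains a parallel pair `{a, a'}` with a rank-`2`
complement, `W` sends at least `60`: the four disjoint units `B − x` (`x ∈ nonco(W)`; `B − a`, `B − a'` of the common
weight `wt`, the other two `≥ 12`) and the `m := #(cw(W, a) ∖ S)` clean units `K ∪ R + w` of weight `4` give
`2·wt + 24 + 4·m ≥ 60` in every case (`wt = 16`, `m = 1`; or `wt = 60 / (m + 1)`, `m ≤ 4`). -/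
theorem sixty_le_sum_pwt60b_of_card_eq_four (hn : (gr M).card = 12) (hR : rk M (gr M) = 5)
    (hll : ∀ x ∈ gr M, rk M {x} = 1)
    (hq2 : ∀ D ⊆ gr M, D.card = 4 → rk M D = 2 → (∃ P ⊆ D, P.card = 3 ∧ rk M P = 1) ∨
      (∃ a ∈ D, ∃ a' ∈ D, a ≠ a' ∧ rk M {a, a'} ≤ 1 ∧ rk M (D \ {a, a'}) = 2))
    {S : Finset α} (hS : S ⊆ gr M) (hS1 : S.card = 1) {W : Finset α} (hW : W ∈ pdem M S)
    (h4 : (nonco M W).card = 4) : 60 ≤ ∑ U ∈ punit M S, pwt60b M S W U := by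
  obtain ⟨hWg, hW5, hSW, hWr, hWc⟩ := mem_pdem.1 hW
  obtain ⟨_, hr2, _, hnotriple⟩ := nonco_facts_of_card_eq_four hn hW h4
  have hBg : gr M \ W ⊆ gr M := sdiff_subset
  have hncB : nonco M W ⊆ gr M \ W := filter_subset _ _
  have hncg : nonco M W ⊆ gr M := hncB.trans hBg
  rcases hq2 (nonco M W) hncg h4 hr2 with htriple | ⟨a, ha, a', ha', haa', hpar, hRr⟩
  · exact absurd htriple hnotriple
  -- the four disjoint units
  have hF₁ : (nonco M W).image (fun p => (gr M \ W).erase p) ⊆ punit M S := by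
    rw [← filter_punit_inter_eq_image hn hR hW]
    exact filter_subset _ _
  have hinj₁ : Set.InjOn (fun p => (gr M \ W).erase p) (nonco M W) :=
    fun p hp p' hp' h => (gr M \ W).erase_injOn (hncB (mem_coe.1 hp)) (hncB (mem_coe.1 hp')) h
  have hge12 : ∀ p ∈ nonco M W, 12 ≤ pwt60b M S W ((gr M \ W).erase p) := by
    intro p hp
    have hU : (gr M \ W).erase p ∈ punit M S := hF₁ (mem_image_of_mem _ hp)
    exact twelve_le_pwt60b_of_inter_eq_empty hn hR hS hS1 hW hU
      (disjoint_iff_inter_eq_empty.1 (disjoint_of_subset_right (erase_subset _ _) sdiff_disjoint.symm))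
  have hcw : cw M W a' = cw M W a :=
    cw_eq_of_parallel hll hWg (hncg ha') (hncg ha) (by rw [Finset.pair_comm]; exact hpar)
  set wt := pwt60b M S W ((gr M \ W).erase a) with hwt
  have hwt' : pwt60b M S W ((gr M \ W).erase a') = wt := by
    rw [hwt, pwt60b_erase_eq hW ha', pwt60b_erase_eq hW ha, hcw]
  have hsum₁ : 2 * wt + 24 ≤ ∑ U ∈ (nonco M W).image (fun p => (gr M \ W).erase p), pwt60b M S W U := by
    rw [sum_image hinj₁, ← add_sum_erase _ _ ha, ← add_sum_erase _ _ (mem_erase.2 ⟨haa'.symm, ha'⟩), hwt']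
    have hrest : 12 * (((nonco M W).erase a).erase a').card ≤
        ∑ p ∈ ((nonco M W).erase a).erase a', pwt60b M S W ((gr M \ W).erase p) := by
      rw [mul_comm, ← smul_eq_mul]
      apply card_nsmul_le_sum
      intro p hp
      exact hge12 p (mem_of_mem_erase (mem_of_mem_erase hp))
    have hcard : (((nonco M W).erase a).erase a').card = 2 := by
      rw [card_erase_of_mem (mem_erase.2 ⟨haa'.symm, ha'⟩), card_erase_of_mem ha, h4]
    rw [hcard] at hrest
    omega
  -- the clean units
  set T := cw M W a \ S with hT
  have hcl : ∀ w ∈ T, insert w ((gr M \ W) \ {a, a'}) ∈ punit M S ∧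
      pwt60b M S W (insert w ((gr M \ W) \ {a, a'})) = 4 :=
    fun w hw => clean_pair_unit_facts hn hR hll hW h4 ha ha' haa' hpar hRr hw
  have hTW : T ⊆ W := fun w hw => (filter_subset _ _ (mem_sdiff.1 hw).1)
  have hF₂ : T.image (fun w => insert w ((gr M \ W) \ {a, a'})) ⊆ punit M S := by
    intro U hU
    obtain ⟨w, hw, rfl⟩ := mem_image.1 hU
    exact (hcl w hw).1
  have hinj₂ : Set.InjOn (fun w => insert w ((gr M \ W) \ {a, a'})) T := by
    intro w hw w' hw' h
    simp only at h
    have hwW : w ∈ W := hTW (mem_coe.1 hw)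
    have h1 : w ∈ insert w' ((gr M \ W) \ {a, a'}) := by rw [← h]; exact mem_insert_self _ _
    rw [mem_insert] at h1
    rcases h1 with h1 | h1
    · exact h1
    · exact absurd hwW (mem_sdiff.1 (mem_sdiff.1 h1).1).2
  have hsum₂ : ∑ U ∈ T.image (fun w => insert w ((gr M \ W) \ {a, a'})), pwt60b M S W U = 4 * T.card := by
    rw [sum_image hinj₂, sum_congr rfl (fun w hw => (hcl w hw).2), sum_const, smul_eq_mul, mul_comm]
  have hdisj : Disjoint ((nonco M W).image (fun p => (gr M \ W).erase p))
      (T.image (fun w => insert w ((gr M \ W) \ {a, a'}))) := by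
    rw [disjoint_left]
    intro U hU₁ hU₂
    obtain ⟨p, _, rfl⟩ := mem_image.1 hU₁
    obtain ⟨w, hw, hw'⟩ := mem_image.1 hU₂
    have : w ∈ (gr M \ W).erase p := by rw [← hw']; exact mem_insert_self _ _
    exact (mem_sdiff.1 (erase_subset _ _ this)).2 (hTW hw)
  -- the arithmetic of the six cases
  have hm4 := card_cw_sdiff_le_four hW hS1 a
  have key : 60 ≤ 2 * wt + 24 + 4 * T.card := by
    rw [hwt, hT, pwt60b_erase_eq hW ha]
    split_ifs with h20
    · have : cw M W a \ S = cw M W a := by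
        rw [Finset.sdiff_eq_self_iff_disjoint, disjoint_iff_inter_eq_empty]
        exact h20.2
      rw [this, h20.1]
    · interval_cases (cw M W a \ S).card <;> norm_num
  calc 60 ≤ 2 * wt + 24 + 4 * T.card := key
    _ ≤ ∑ U ∈ (nonco M W).image (fun p => (gr M \ W).erase p), pwt60b M S W U +
          ∑ U ∈ T.image (fun w => insert w ((gr M \ W) \ {a, a'})), pwt60b M S W U := by
        rw [hsum₂]; omega
    _ = ∑ U ∈ (nonco M W).image (fun p => (gr M \ W).erase p) ∪
          T.image (fun w => insert w ((gr M \ W) \ {a, a'})), pwt60b M S W U := (sum_union hdisj).symm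
    _ ≤ ∑ U ∈ punit M S, pwt60b M S W U := sum_le_sum_of_subset (union_subset hF₁ hF₂)

/-- **THE POINT INEQUALITY IN THE DUAL, SECOND QUAD REGIME**: on a loopless matroid of rank `5` with `12` points in
which every four points of rank `2` contain three pairwise parallel points or a parallel pair with a rank-`2`
complement, for every singleton `S ⊆ E` the bases `W ⊇ S` with spanning complement are at most the spanning
`6`-sets avoiding `S` with spanning complement (`60·#𝒟 ≤ Σ pwt60b ≤ 60·#𝒰`). -/
theorem card_pdem_le_card_punit_of_quad2 (hn : (gr M).card = 12) (hR : rk M (gr M) = 5)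
    (hll : ∀ x ∈ gr M, rk M {x} = 1)
    (hq2 : ∀ D ⊆ gr M, D.card = 4 → rk M D = 2 → (∃ P ⊆ D, P.card = 3 ∧ rk M P = 1) ∨
      (∃ a ∈ D, ∃ a' ∈ D, a ≠ a' ∧ rk M {a, a'} ≤ 1 ∧ rk M (D \ {a, a'}) = 2))
    {S : Finset α} (hS : S ⊆ gr M) (hS1 : S.card = 1) : (pdem M S).card ≤ (punit M S).card := by
  have h1 : 60 * (pdem M S).card ≤ ∑ W ∈ pdem M S, ∑ U ∈ punit M S, pwt60b M S W U := by
    rw [mul_comm, ← smul_eq_mul]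
    apply card_nsmul_le_sum
    intro W hW
    by_cases hd : deficient M W
    · exact sixty_le_sum_pwt60b_of_deficient hn hR hll hS1 hW hd
    · by_cases h4 : (nonco M W).card = 4
      · exact sixty_le_sum_pwt60b_of_card_eq_four hn hR hll hq2 hS hS1 hW h4
      · exact sixty_le_sum_pwt60b_of_five_le hn hR hS hS1 hW (by unfold deficient at hd; omega)
  have h2 : ∑ W ∈ pdem M S, ∑ U ∈ punit M S, pwt60b M S W U ≤ 60 * (punit M S).card := by
    rw [sum_comm, mul_comm, ← smul_eq_mul]
    apply sum_le_card_nsmul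
    intro U hU
    exact sum_pwt60b_le_sixty hn hR hS hU
  omega

end TwelveQuadE

section TwelveQuad2Transfer

variable {N : Matroid α} [N.Finite]

/-- **THE SECOND QUAD REGIME ON COLOOP-FREE GROUND SETS**: `#E = 12`, `ρ(E) = 7`, no coloops, and every `4`-set `D`
with `ρ(E ∖ D) = 5` contains a `3`-set `P` with `ρ(E ∖ P) = 5` or a pair `{a, a'}` with `ρ(E ∖ {a, a'}) = 6` and
`ρ(E ∖ (D ∖ {a, a'})) = 7` ⟹ `in_5(e) ≤ out_6(e)` at every point `e` (the dual count for `S = {e}`). -/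
theorem inCount_five_le_outCount_six_of_twelve_of_cf_of_quad2 (hn : (gr N).card = 12)
    (hR7 : rk N (gr N) = 7) (hcf : ∀ x ∈ gr N, rk N ((gr N).erase x) = rk N (gr N))
    (hq2 : ∀ D ⊆ gr N, D.card = 4 → rk N (gr N \ D) = 5 →
      (∃ P ⊆ D, P.card = 3 ∧ rk N (gr N \ P) = 5) ∨
      (∃ a ∈ D, ∃ a' ∈ D, a ≠ a' ∧ rk N (gr N \ {a, a'}) = 6 ∧ rk N (gr N \ (D \ {a, a'})) = 7))
    {e : α} (he : e ∈ gr N) : inCount N 5 e ≤ outCount N 6 e := by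
  have hR : rk (N✶) (gr (N✶)) = 5 := by
    rw [gr_dual]
    have := rk_dual_add_rk (M := N)
    omega
  have hll : ∀ x ∈ gr (N✶), rk (N✶) {x} = 1 := by
    intro x hx
    rw [gr_dual] at hx
    have h := (rk_dual_eq_card_iff (singleton_subset_iff.2 hx)).2 (by
      rw [sdiff_singleton_eq_erase]; exact hcf x hx)
    rw [h, card_singleton]
  have h12 : (gr (N✶)).card = 12 := by rw [gr_dual]; exact hn
  have hSd : ({e} : Finset α) ⊆ gr (N✶) := by rw [gr_dual]; exact singleton_subset_iff.2 he
  -- the hypothesis in the dual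
  have hqd : ∀ D ⊆ gr (N✶), D.card = 4 → rk (N✶) D = 2 → (∃ P ⊆ D, P.card = 3 ∧ rk (N✶) P = 1) ∨
      (∃ a ∈ D, ∃ a' ∈ D, a ≠ a' ∧ rk (N✶) {a, a'} ≤ 1 ∧ rk (N✶) (D \ {a, a'}) = 2) := by
    intro D hD hD4 hDr
    rw [gr_dual] at hD
    have h1 := rk_dual_add_rk_gr_eq hD
    rcases hq2 D hD hD4 (by omega) with ⟨P, hPD, hP3, hPr⟩ | ⟨a, ha, a', ha', haa', hpair, hrest⟩
    · left
      refine ⟨P, hPD, hP3, ?_⟩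
      have h2 := rk_dual_add_rk_gr_eq (hPD.trans hD)
      omega
    · right
      refine ⟨a, ha, a', ha', haa', ?_, ?_⟩
      · have hsub : ({a, a'} : Finset α) ⊆ gr N := insert_subset (hD ha) (singleton_subset_iff.2 (hD ha'))
        have h2 := rk_dual_add_rk_gr_eq hsub
        rw [card_pair haa'] at h2
        omega
      · have hsub : D \ {a, a'} ⊆ gr N := sdiff_subset.trans hD
        have h2 := rk_dual_add_rk_gr_eq hsub
        have hc : (D \ {a, a'}).card = 2 := by
          rw [card_sdiff_of_subset (insert_subset ha (singleton_subset_iff.2 ha')), hD4, card_pair haa']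
        omega
  have hmain := card_pdem_le_card_punit_of_quad2 h12 hR hll hqd hSd (card_singleton e)
  have eD : (biIndepSets N 5).filter (fun W => e ∈ W) = pdem (N✶) {e} := by
    ext W
    rw [mem_filter, mem_biIndepSets, mem_pdem, gr_dual, singleton_subset_iff]
    constructor
    · rintro ⟨⟨hWg, hW5, hWr, hWc⟩, heW⟩
      have h := (biIndep_iff_dual_spanning hWg).1 ⟨hWr, hWc⟩
      rw [hR] at h
      exact ⟨hWg, hW5, heW, h.1, h.2⟩
    · rintro ⟨hWg, hW5, heW, h1, h2⟩
      have h := (biIndep_iff_dual_spanning hWg).2 (by rw [hR]; exact ⟨h1, h2⟩)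
      exact ⟨⟨hWg, hW5, h.1, h.2⟩, heW⟩
  have eU : (biIndepSets N 6).filter (fun U => e ∉ U) = punit (N✶) {e} := by
    ext U
    rw [mem_filter, mem_biIndepSets, mem_punit, gr_dual]
    have hUe : U ∩ {e} = ∅ ↔ e ∉ U := by
      rw [← disjoint_iff_inter_eq_empty, disjoint_singleton_right]
    rw [hUe]
    constructor
    · rintro ⟨⟨hUg, hU6, hUr, hUc⟩, heU⟩
      have h := (biIndep_iff_dual_spanning hUg).1 ⟨hUr, hUc⟩
      rw [hR] at h
      exact ⟨hUg, hU6, heU, h.1, h.2⟩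
    · rintro ⟨hUg, hU6, heU, h1, h2⟩
      have h := (biIndep_iff_dual_spanning hUg).2 (by rw [hR]; exact ⟨h1, h2⟩)
      exact ⟨⟨hUg, hU6, h.1, h.2⟩, heU⟩
  unfold inCount outCount
  rw [eD, eU]
  exact hmain

/-- **THE SECOND QUAD REGIME OF `InOutBottomTwelve`**: on every matroid with `12` points and rank `7` in which every
`4`-set `D` with `ρ(E ∖ D) = 5` contains a `3`-set `P` with `ρ(E ∖ P) = 5` or a pair `{a, a'}` with
`ρ(E ∖ {a, a'}) = 6` and `ρ(E ∖ (D ∖ {a, a'})) = 7` — every co-rank-2 quadruple contains a series triple or a series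
pair with co-independent complement — `in_5(e) ≤ out_6(e)` at every point `e`. -/
theorem inCount_five_le_outCount_six_of_twelve_of_quad2 (hn : (gr N).card = 12) (hR7 : rk N (gr N) = 7)
    (hq2 : ∀ D ⊆ gr N, D.card = 4 → rk N (gr N \ D) = 5 →
      (∃ P ⊆ D, P.card = 3 ∧ rk N (gr N \ P) = 5) ∨
      (∃ a ∈ D, ∃ a' ∈ D, a ≠ a' ∧ rk N (gr N \ {a, a'}) = 6 ∧ rk N (gr N \ (D \ {a, a'})) = 7))
    {e : α} (he : e ∈ gr N) : inCount N 5 e ≤ outCount N 6 e := by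
  have hn5 : (gr N).card = rk N (gr N) + 5 := by omega
  by_cases hce : rk N ((gr N).erase e) < rk N (gr N)
  · exact inCount_five_le_outCount_six_of_coloop hn5 hce
  by_cases hx : ∃ x ∈ (gr N).erase e, rk N ((gr N).erase x) < rk N (gr N)
  · obtain ⟨x, hx, hco⟩ := hx
    have hxg : x ∈ gr N := (mem_erase.1 hx).2
    have hxe : x ≠ e := (mem_erase.1 hx).1
    have hrk : rk N ((gr N).erase x) + 1 = rk N (gr N) := by
      have := rk_le_rk_erase_add_one (M := N) (Subset.refl (gr N)) hxg
      omega
    have h1 := inCount_bottom_le_inCount_delete_of_coloop (ν := 5) (e := e) hn5 hco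
    have h2 := outCount_delete_le_outCount_of_coloop' 6 (e := e) hxg hco
    have hn' : (gr (N ＼ ({x} : Set α))).card =
        rk (N ＼ ({x} : Set α)) (gr (N ＼ ({x} : Set α))) + 5 := by
      rw [gr_delete', card_erase_of_mem hxg, rk_delete (Subset.refl _)]; omega
    have he' : e ∈ gr (N ＼ ({x} : Set α)) := by
      rw [gr_delete']; exact mem_erase.2 ⟨hxe.symm, he⟩
    have h3 := inCount_five_eq_outCount_six_of_rk_eq_six (N := N ＼ ({x} : Set α)) hn'
      (by rw [gr_delete', rk_delete (Subset.refl _)]; omega) he'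
    omega
  · have hcf : ∀ x ∈ gr N, rk N ((gr N).erase x) = rk N (gr N) := by
      intro x hxg
      have hle := rk_mono' (M := N) (erase_subset x (gr N))
      by_cases hxe : x = e
      · rw [hxe] at hle ⊢; omega
      · have : ¬ rk N ((gr N).erase x) < rk N (gr N) := fun h => hx ⟨x, mem_erase.2 ⟨hxe, hxg⟩, h⟩
        omega
    exact inCount_five_le_outCount_six_of_twelve_of_cf_of_quad2 hn hR7 hcf hq2 he

end TwelveQuad2Transfer


end PercRepro.Cogirth
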